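import Summits.CriticalPhenomena.SAWScalingLimit.Theorems.SAWLoopFugacityFlowSimpleSubseqLimitsStubRangeIsArcAgree
import Summits.CriticalPhenomena.SAWScalingLimit.Theorems.SAWLoopFugacityFlowSimpleSubseqLimitsStubRangeIsArcSeparate
import Literature.Probability.RandomPlanarGeometry.CaratheodoryHalfPlaneProofs
import HarnessLib

/-!
# The test family — stub `stub_rangeIsArc_tests` of the line `marked-point-revisit`
(crux `SAWLoopFugacityFlow.SimpleSubseqLimits`, stmt-CriticalPhenomena-4982; plan `RangeIsArc-PLAN.md`, sub-stub 3)

For a Dobrushin domain `(D; a, b)`, a probability measure `ν` carried by curve classes from `a`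
to `b` with trace in `D ∪ {a, b}`, a probability measure `μ` carried by the chordal carrier
(simple chords), and `AvoidanceAgree D ν μ`, we produce closed test sets `C n ⊆ ℂ` such that
(1) the avoidance code of `C` is injective on the chordal carrier, (2) `ν` and `μ` agree on the
avoidance events of all finite unions `⋃ n ∈ s, C n`, and (3) a carrier class with the code of a
chordal simple class has its trace.

Construction: `C n = φ̄(T_n)` for a chordal uniformizing map `φ` of `(D; a, b)`
(`MarkedDomain.exists_isChordalUniformizing_holds`) and `T_n` the `n`-th rational test set of the
half-plane (`testSet`, `HalfPlaneAnchors`) if it is anchored with all its real points of ONE sign,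
`∅` otherwise. A finite union of such sets is `Tp ∪ Tm` with `Tp` (resp. `Tm`) empty or anchored
with positive (resp. negative) real points, so (2) is `ArcRangeAgree.stub_rangeIsArc_agree`;
(3) is `ArcRangeSeparate.stub_rangeIsArc_separate` (one-signed anchored sets separate points from
chordal simple traces), and (1) follows from (3) by `CurveClass.eq_of_mem_simple_of_range_eq`.
-/

noncomputable section

open MeasureTheory Filter Topology Set Metric Bornology
open Literature.Probability.RandomPlanarGeometry
open UpperHalfPlane (upperHalfPlaneSet isOpen_upperHalfPlaneSet)
open Summit.CriticalPhenomena.SAWScalingLimit.Theorems.SimpleSubseqLimits.MarkedPointRevisit.Glue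
open scoped ENNReal NNReal unitInterval

namespace Summit.CriticalPhenomena.SAWScalingLimit.Theorems.SimpleSubseqLimits.MarkedPointRevisit.ArcRangeTests

/-! ### The countable test family and the registered statement -/

section Family

variable (Q : List (ℚ × ℚ × ℚ) → Prop) [DecidablePred Q]

/-- The union over a finite set of indices of the test sets satisfying `Q`. [folklore] -/
theorem biUnion_ite_spec (hQ : ∀ l, Q l → IsAnchored (testSet l)) (s : Finset ℕ) :
    ((⋃ n ∈ s, if Q (Denumerable.ofNat (List (ℚ × ℚ × ℚ)) n) then
        testSet (Denumerable.ofNat (List (ℚ × ℚ × ℚ)) n) else (∅ : Set ℂ)) = ∅ ∨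
      IsAnchored (⋃ n ∈ s, if Q (Denumerable.ofNat (List (ℚ × ℚ × ℚ)) n) then
        testSet (Denumerable.ofNat (List (ℚ × ℚ × ℚ)) n) else (∅ : Set ℂ))) ∧
    IsCompact (⋃ n ∈ s, if Q (Denumerable.ofNat (List (ℚ × ℚ × ℚ)) n) then
        testSet (Denumerable.ofNat (List (ℚ × ℚ × ℚ)) n) else (∅ : Set ℂ)) ∧
    (⋃ n ∈ s, if Q (Denumerable.ofNat (List (ℚ × ℚ × ℚ)) n) then
        testSet (Denumerable.ofNat (List (ℚ × ℚ × ℚ)) n) else (∅ : Set ℂ)) ⊆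
      closure upperHalfPlaneSet ∧
    ∀ z ∈ (⋃ n ∈ s, if Q (Denumerable.ofNat (List (ℚ × ℚ × ℚ)) n) then
        testSet (Denumerable.ofNat (List (ℚ × ℚ × ℚ)) n) else (∅ : Set ℂ)),
      ∃ l, Q l ∧ z ∈ testSet l := by
  refine ⟨?_, ?_, ?_, ?_⟩
  · induction s using Finset.induction_on with
    | empty => left; simp
    | insert a s ha ih =>
      rw [Finset.set_biUnion_insert]
      by_cases hQa : Q (Denumerable.ofNat (List (ℚ × ℚ × ℚ)) a)
      · rw [if_pos hQa]
        rcases ih with h | h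
        · rw [h, union_empty]; exact Or.inr (hQ _ hQa)
        · exact Or.inr ((hQ _ hQa).union h)
      · rw [if_neg hQa, empty_union]; exact ih
  · refine s.finite_toSet.isCompact_biUnion fun n _ ↦ ?_
    split_ifs
    · exact isCompact_testSet _
    · exact isCompact_empty
  · refine iUnion₂_subset fun n _ ↦ ?_
    split_ifs
    · exact testSet_subset_closure _
    · exact empty_subset _
  · intro z hz
    simp only [mem_iUnion, exists_prop] at hz
    obtain ⟨n, -, hn⟩ := hz
    split_ifs at hn with h
    · exact ⟨_, h, hn⟩
    · exact absurd hn (Set.notMem_empty z)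

end Family

/-- **Sub-stub 3 of `stub_rangeIsArc` — the test family.** For `ν` carried by classes from `a`
to `b` in `D ∪ {a, b}`, `μ` carried by the chordal carrier, and `AvoidanceAgree D ν μ`: a
sequence of closed test sets (the images under the boundary extension of a chordal uniformizing
map of the one-signed anchored rational test sets of the half-plane) whose avoidance code is
injective on the chordal carrier, on whose finite-union avoidance events `ν` and `μ` agree, and
whose code determines the trace of a carrier class against a chordal simple class. [folklore] -/
theorem stub_rangeIsArc_tests :
    ∀ (D : DobrushinDomain) (ν μ : Measure (CurveClass ℂ)), IsProbabilityMeasure ν →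
      IsProbabilityMeasure μ →
      (∀ᵐ c ∂ν, c.source = D.pt 0 ∧ c.target = D.pt 1 ∧
        c.range ⊆ D.carrier ∪ {D.pt 0, D.pt 1}) →
      (∀ᵐ γ ∂μ, γ ∈ chordalCarrier D) → AvoidanceAgree D ν μ →
      ∃ C : ℕ → Set ℂ, (∀ n, IsClosed (C n)) ∧ InjOn (CurveClass.missCode C) (chordalCarrier D) ∧
        (∀ s : Finset ℕ, ν (CurveClass.rangeSubset (⋃ n ∈ s, C n)ᶜ) =
          μ (CurveClass.rangeSubset (⋃ n ∈ s, C n)ᶜ)) ∧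
        ∀ c : CurveClass ℂ, c.source = D.pt 0 → c.target = D.pt 1 →
          c.range ⊆ D.carrier ∪ {D.pt 0, D.pt 1} → ∀ γ ∈ chordalCarrier D,
          CurveClass.missCode C c = CurveClass.missCode C γ → c.range = γ.range := by
  intro D ν μ _ _ hν hμ hA
  classical
  obtain ⟨φ, hφ⟩ := MarkedDomain.exists_isChordalUniformizing_holds D
  have hC := JordanDomain.exists_continuousOn_extension_holds
  have hμ' : ∀ᵐ c ∂μ, c.source = D.pt 0 ∧ c.target = D.pt 1 ∧
      c.range ⊆ D.carrier ∪ {D.pt 0, D.pt 1} :=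
    hμ.mono fun c hc ↦ ⟨hc.1.1.2, hc.1.2, hc.2⟩
  -- one-signed anchored lists and the test family
  set ofN := Denumerable.ofNat (List (ℚ × ℚ × ℚ)) with hofN
  set Pp : List (ℚ × ℚ × ℚ) → Prop := fun l ↦
    IsAnchored (testSet l) ∧ ∀ x : ℝ, (x : ℂ) ∈ testSet l → 0 < x with hPp
  set Pm : List (ℚ × ℚ × ℚ) → Prop := fun l ↦
    ¬ Pp l ∧ IsAnchored (testSet l) ∧ ∀ x : ℝ, (x : ℂ) ∈ testSet l → x < 0 with hPm
  set Tst : ℕ → Set ℂ := fun n ↦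
    (if Pp (ofN n) then testSet (ofN n) else ∅) ∪ (if Pm (ofN n) then testSet (ofN n) else ∅)
    with hTst
  have hTst_of : ∀ {l}, IsAnchored (testSet l) →
      ((∀ x : ℝ, (x : ℂ) ∈ testSet l → 0 < x) ∨ (∀ x : ℝ, (x : ℂ) ∈ testSet l → x < 0)) →
      ∃ n, Tst n = testSet l := by
    intro l hl hsgn
    obtain ⟨n, hn⟩ : ∃ n, ofN n = l := ⟨_, Denumerable.ofNat_encode l⟩
    refine ⟨n, ?_⟩
    simp only [hTst, hn]
    by_cases hp : Pp l
    · rw [if_pos hp]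
      by_cases hm : Pm l
      · rw [if_pos hm, union_self]
      · rw [if_neg hm, union_empty]
    · rw [if_neg hp, empty_union, if_pos]
      refine ⟨hp, hl, ?_⟩
      rcases hsgn with h | h
      · exact absurd ⟨hl, h⟩ hp
      · exact h
  have hTst_sub : ∀ n, Tst n ⊆ closure upperHalfPlaneSet ∧ IsCompact (Tst n) := by
    intro n
    simp only [hTst]
    constructor
    · refine union_subset ?_ ?_ <;> split_ifs <;>
        first | exact testSet_subset_closure _ | exact empty_subset _
    · refine IsCompact.union ?_ ?_ <;> split_ifs <;> first | exact isCompact_testSet _ | exact isCompact_empty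
  set C : ℕ → Set ℂ := fun n ↦ φ.boundaryExtension '' Tst n with hCdef
  -- separation
  have hsep : ∀ c : CurveClass ℂ, c.source = D.pt 0 → c.target = D.pt 1 →
      c.range ⊆ D.carrier ∪ {D.pt 0, D.pt 1} → ∀ γ ∈ chordalCarrier D,
      CurveClass.missCode C c = CurveClass.missCode C γ → c.range = γ.range := by
    intro c hs ht hr γ hγ hcode
    refine ArcRangeSeparate.stub_rangeIsArc_separate D φ c γ hφ hs ht hr hγ fun l hl hsgn hdisj ↦ ?_
    obtain ⟨n, hT⟩ := hTst_of hl hsgn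
    have hγn : CurveClass.missCode C γ n = true :=
      CurveClass.missCode_eq_true_iff.2 (by simp only [hCdef, hT]; exact hdisj)
    rw [← hcode] at hγn
    have := CurveClass.missCode_eq_true_iff.1 hγn
    simp only [hCdef, hT] at this
    exact this
  refine ⟨C, fun n ↦ (MarkedDomain.isCompact_image_boundaryExtension hC (hTst_sub n).1
    (hTst_sub n).2).isClosed, ?_, fun s ↦ ?_, hsep⟩
  · intro γ₁ h₁ γ₂ h₂ hcode
    exact CurveClass.eq_of_mem_simple_of_range_eq h₁.1.1.1 h₂.1.1.1
      (hsep γ₁ h₁.1.1.2 h₁.1.2 h₁.2 γ₂ h₂ hcode) (h₁.1.1.2.trans h₂.1.1.2.symm)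
  · -- finite unions: `⋃ n ∈ s, C n = φ̄ '' (Tp ∪ Tm)`
    set Tp : Set ℂ := ⋃ n ∈ s, if Pp (ofN n) then testSet (ofN n) else ∅ with hTp
    set Tm : Set ℂ := ⋃ n ∈ s, if Pm (ofN n) then testSet (ofN n) else ∅ with hTm
    have hunion : (⋃ n ∈ s, C n) = φ.boundaryExtension '' (Tp ∪ Tm) := by
      simp only [hCdef, hTst, hTp, hTm, image_union, image_iUnion]
      ext w
      simp only [mem_iUnion, mem_union, exists_prop]
      constructor
      · rintro ⟨n, hn, h | h⟩
        · exact Or.inl ⟨n, hn, h⟩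
        · exact Or.inr ⟨n, hn, h⟩
      · rintro (⟨n, hn, h⟩ | ⟨n, hn, h⟩)
        · exact ⟨n, hn, Or.inl h⟩
        · exact ⟨n, hn, Or.inr h⟩
    obtain ⟨hap, hTpc, hTpcl, hTpmem⟩ := biUnion_ite_spec Pp (fun l hl ↦ hl.1) s
    obtain ⟨ham, hTmc, hTmcl, hTmmem⟩ := biUnion_ite_spec Pm (fun l hl ↦ hl.2.1) s
    have hpos : ∀ x : ℝ, (x : ℂ) ∈ Tp → 0 < x := fun x hx ↦ by
      obtain ⟨l, hl, hxl⟩ := hTpmem _ hx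
      exact hl.2 x hxl
    have hneg : ∀ x : ℝ, (x : ℂ) ∈ Tm → x < 0 := fun x hx ↦ by
      obtain ⟨l, hl, hxl⟩ := hTmmem _ hx
      exact hl.2.2 x hxl
    rw [hunion]
    exact ArcRangeAgree.measure_avoid_eq hφ hTpc hTmc hTpcl hTmcl hap ham hpos hneg hν hμ' hA

end Summit.CriticalPhenomena.SAWScalingLimit.Theorems.SimpleSubseqLimits.MarkedPointRevisit.ArcRangeTests

end
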